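import Literature.AnabelianGeometry.AbsoluteAnabelian.AbsTopIProp410LeftCofinalOpenness
import Literature.AnabelianGeometry.SemiGraphs.TemperedPolish
import HarnessLib

/-!
# [AbsTopI] Prop 4.10 (iii) at the construction: the Δ-SURJECTIVE case — conj. 1 of
# `CoFreeCofinalImAlong` follows from row iii.L03 by the open mapping theorem (proof-only)

S. Mochizuki, *Topics in Absolute Anabelian Geometry I: Generalities* [AbsTopI] (2012), §0 p. 8,
Def 4.2 (iii)(c) p. 50 ("a surjection `Π_j ↠ Π_{j+1}`"), Prop 4.10 (iii) p. 60, Def 4.11 (i)(c)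
p. 62; manuscript pagination, lit key `paper:url-11ac98ba15fc`, read on the page.  [SemiAnbd] Def 3.1
(i) p. 33 (tempered groups; the tree's OPEN MAPPING THEOREM for tempered groups,
`IsTempered.isOpenMap_of_surjective_of_isTempered`, `TemperedPolish.lean`).

Context: node AbsTopI:Prop4.10(iii) of `HOME/plan/L4/SUBDAG-AbsTopI-Prop410.md`.  Its closers take
the morphism-level residue conj. 1 `hleft`, which is NOT derivable from the intrinsic residues
(`AbsTopIProp410TemperedModelSchemaNegative.lean`: there `f(Δ^tp_X)` is only DENSE in a profinite
`Δ^tp_Y`) and is EQUIVALENT to the openness of the traces `toHat_Y⁻¹(K_X(H)) ∩ Δ^tp_Y`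
(`AbsTopIProp410LeftCofinalOpenness.lean`).  THIS FILE discharges conj. 1 from the sub-DAG's own ROW
iii.L03 — `DeCuspidalization.Surjective` (typed in `AbsTopIProp410Sub.lean`: `f` onto and
`f(Δ^tp_X) = Δ^tp_Y`; Def 4.2 (iii)(c) read at the tempered level, STRONGER than Def 4.11 (i)(c)'s
"dense") — in fact from its Δ-clause alone:
* `isOpen_subgroupOf_delta_of_isCofreeIn` — a co-free subgroup of an index `H` is open in `Δ^tp`;
* `isOpenMap_fDelta_of_surjective` — `Δ^tp_X ↠ Δ^tp_Y` surjective ⇒ OPEN (both `Δ^tp` are tempered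
  and first countable by `dX`, `dY`: open mapping theorem);
* `coFreeKernel_cofinal_left_of_fDelta_surjective` — conj. 1 from {(CF_Δ) on `Y`, `hmin` on `X`,
  `dX`, `dY`, `Δ^tp_X ↠ Δ^tp_Y`}: `f(H^{co-fr})` is then an open subgroup of `Δ^tp_Y`
  (`coFreeKernel_cofinal_left_of_image_mem_nhds`);
* **`prop410iii_of_fDelta_surjective`** — BOTH clauses of node (iii) AT THE CONSTRUCTION over
  {`f(Δ^tp_X) = Δ^tp_Y`, (CF_Δ)_Y, `hmin_X`, `hmin_Y`, tfg `Δ^tp_X`, `dX`, `dY`} — every residue now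
  either a typed ROW of the sub-DAG (iii.L03) or INTRINSIC to one curve; `prop410iii_of_surjective`
  the same from `E.Surjective`.
Proof-only (no `def`/instance/named fact; FACT-LIST untouched).  HONEST NOTE: whether the printed
tempered arrow of a de-cuspidalization is onto (not merely dense) is a question about André's `π₁^tp`
that the tree cannot yet ask; the row is consumed BY NAME.  No side taken on [IUTchIII] Cor 3.12;
typed ≠ proved.
-/

noncomputable section

open _root_.Topology Filter

namespace Literature.AnabelianGeometry.AbsoluteAnabelian.AbsTopI

open Literature.AnabelianGeometry.SemiGraphs

/-! ### A co-free subgroup of an index is open in `Δ` -/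

section Open

variable {P : Type*} [Group P] [TopologicalSpace P]

/-- A co-free subgroup `M` of an index `H : CharOpenSubgroup Δ` is OPEN in `Δ` (`M` is open in `H`,
`H` is open in `Δ`, and `H ↪ Δ` is an open embedding). [cite: MochizukiAbsTopI2012, §0 p.8] -/
theorem CharOpenSubgroup.isOpen_subgroupOf_of_isCofreeIn {Δ : Subgroup P} (H : CharOpenSubgroup Δ)
    {M : Subgroup P} (hM : IsCofreeIn H.toSubgroup M) :
    IsOpen ((M.subgroupOf Δ : Subgroup Δ) : Set Δ) := by
  obtain ⟨hMle, hN, hcf⟩ := hM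
  let j : H.toSubgroup → Δ := fun h => ⟨h.1, H.le h.2⟩
  have hj : Topology.IsOpenEmbedding j := by
    refine ⟨?_, ?_⟩
    · exact Topology.IsEmbedding.of_comp (continuous_subtype_val.subtype_mk _)
        continuous_subtype_val Topology.IsEmbedding.subtypeVal
    · have : Set.range j = ((H.toSubgroup.subgroupOf Δ : Subgroup Δ) : Set Δ) := by
        ext y
        constructor
        · rintro ⟨h, rfl⟩; exact Subgroup.mem_subgroupOf.mpr h.2
        · intro hy; exact ⟨⟨y.1, Subgroup.mem_subgroupOf.mp hy⟩, rfl⟩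
      rw [this]; exact H.isOpen
  have heq : ((M.subgroupOf Δ : Subgroup Δ) : Set Δ) =
      j '' ((M.subgroupOf H.toSubgroup : Subgroup H.toSubgroup) : Set H.toSubgroup) := by
    ext y
    constructor
    · intro hy
      have hyM : (y : P) ∈ M := Subgroup.mem_subgroupOf.mp hy
      exact ⟨⟨y.1, hMle hyM⟩, Subgroup.mem_subgroupOf.mpr hyM, rfl⟩
    · rintro ⟨h, hh, rfl⟩
      exact Subgroup.mem_subgroupOf.mpr (Subgroup.mem_subgroupOf.mp hh)
  rw [heq]
  exact hj.isOpenMap _ hcf.isOpen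

end Open

namespace Prop410

open Literature.AnabelianGeometry.AbsoluteAnabelian.AbsTopI

variable {p : ℕ} [Fact p.Prime]

namespace DeCuspidalization

variable {X Y : TemperedCurve p} (E : DeCuspidalization X Y)

/-- `Δ^tp_Z` is tempered (from the parameter bundle `dZ`: `Δ^tp_Z = Ker(augK)`).
[cite: MochizukiSemiAnbd2006, Ex 3.10 p.43] -/
theorem isTempered_deltaTemp_of_groupLevelData (Z : TemperedCurve p) (dZ : Z.GroupLevelData) :
    IsTempered Z.DeltaTemp := by
  rw [← Z.ker_augK dZ.galEquiv]
  exact dZ.isTempered_ker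

/-- **Row iii.L03 (Δ-clause) ⇒ `Δ^tp_X ↠ Δ^tp_Y` is an OPEN map** — open mapping theorem for the
tempered, Galois-countable groups `Δ^tp_X`, `Δ^tp_Y` (`dX`, `dY`).
[cite: MochizukiAbsTopI2012, Def 4.2 (iii) p.50] -/
theorem isOpenMap_fDelta_of_surjective (dX : X.GroupLevelData) (dY : Y.GroupLevelData)
    (hs : Function.Surjective E.fDelta) : IsOpenMap E.fDelta := by
  haveI : SecondCountableTopology X.PiTemp := dX.secondCountableTopology
  haveI : SecondCountableTopology Y.PiTemp := dY.secondCountableTopology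
  haveI : SecondCountableTopology X.DeltaTemp := TopologicalSpace.Subtype.secondCountableTopology _
  haveI : SecondCountableTopology Y.DeltaTemp := TopologicalSpace.Subtype.secondCountableTopology _
  exact (isTempered_deltaTemp_of_groupLevelData X dX).isOpenMap_of_surjective_of_isTempered
    (isTempered_deltaTemp_of_groupLevelData Y dY) E.fDelta.toMonoidHom E.fDelta.continuous hs

/-- `f(Δ^tp_X) = Δ^tp_Y` (the Δ-clause of row iii.L03) ⇒ `Δ^tp_X → Δ^tp_Y` is surjective.
[cite: MochizukiAbsTopI2012, Def 4.2 (iii) p.50] -/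
theorem fDelta_surjective_of_map_eq (h : X.DeltaTemp.map E.f.toMonoidHom = Y.DeltaTemp) :
    Function.Surjective E.fDelta := by
  intro y
  have hy : (y : Y.PiTemp) ∈ X.DeltaTemp.map E.f.toMonoidHom := by rw [h]; exact y.2
  obtain ⟨x, hx, hxy⟩ := hy
  exact ⟨⟨x, hx⟩, Subtype.ext hxy⟩

/-- **conj. 1 of `CoFreeCofinalImAlong` from Δ-surjectivity**: if `Δ^tp_X ↠ Δ^tp_Y` is onto, (CF_Δ)
holds on `Y` and the X-indices admit minimal co-free subgroups, then for every X-index `H` the image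
`f(H^{co-fr})` is an OPEN subgroup of `Δ^tp_Y`, so some Y-index `H′` has `K_Y(H′) ≤ K_X(H)`.
[cite: MochizukiAbsTopI2012, Prop 4.10 (iii) p.60] -/
theorem coFreeKernel_cofinal_left_of_fDelta_surjective (dX : X.GroupLevelData) (dY : Y.GroupLevelData)
    (hs : Function.Surjective E.fDelta)
    (hΔ : ∀ N : OpenNormalSubgroup Y.DeltaTemp, ∃ H' : CharOpenSubgroup Y.DeltaTemp,
      (cofreeCore H'.toSubgroup).subgroupOf Y.DeltaTemp ≤ N.toSubgroup)
    (hminX : ∀ H : CharOpenSubgroup X.DeltaTemp, ∃ M, IsMinimalCofreeIn H.toSubgroup M) :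
    ∀ H : CharOpenSubgroup X.DeltaTemp, ∃ H' : CharOpenSubgroup Y.DeltaTemp,
      coFreeKernel ((ContinuousMonoidHom.id Y.PiHat).comp Y.toHat) H'.toSubgroup ≤
        coFreeKernel (E.fHat.comp X.toHat) H.toSubgroup := by
  refine E.coFreeKernel_cofinal_left_of_image_mem_nhds hΔ fun H => ?_
  obtain ⟨M, hM⟩ := hminX H
  have hCM : cofreeCore H.toSubgroup = M := cofreeCore_eq_of_isMinimalCofreeIn hM
  have hopen : IsOpen (((cofreeCore H.toSubgroup).subgroupOf X.DeltaTemp : Subgroup X.DeltaTemp) :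
      Set X.DeltaTemp) := by
    rw [hCM]; exact H.isOpen_subgroupOf_of_isCofreeIn hM.1
  refine (E.isOpenMap_fDelta_of_surjective dX dY hs _ hopen).mem_nhds ⟨1, Subgroup.one_mem _, map_one _⟩

/-- **[AbsTopI] Prop 4.10 (iii), BOTH clauses, AT THE CONSTRUCTION in the Δ-SURJECTIVE case** — over
{`Δ^tp_X ↠ Δ^tp_Y`, (CF_Δ) on `Y`, `hmin` on `X` and on `Y`, tfg `Δ^tp_X`, `dX`, `dY`}: every residue
is a typed row of the sub-DAG (iii.L03) or intrinsic to one of the two curves.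
[cite: MochizukiAbsTopI2012, Prop 4.10 (iii) p.60] -/
theorem prop410iii_of_fDelta_surjective (dX : X.GroupLevelData) (dY : Y.GroupLevelData)
    (hs : Function.Surjective E.fDelta)
    (hΔ : ∀ N : OpenNormalSubgroup Y.DeltaTemp, ∃ H' : CharOpenSubgroup Y.DeltaTemp,
      (cofreeCore H'.toSubgroup).subgroupOf Y.DeltaTemp ≤ N.toSubgroup)
    (hminX : ∀ H : CharOpenSubgroup X.DeltaTemp, ∃ M, IsMinimalCofreeIn H.toSubgroup M)
    (hminY : ∀ H' : CharOpenSubgroup Y.DeltaTemp, ∃ M, IsMinimalCofreeIn H'.toSubgroup M)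
    (htfg : IsTopologicallyFinitelyGenerated X.DeltaTemp) :
    Prop410iiiAt E ∧ Prop410iiiDeltaAt E :=
  ⟨prop410iiiAt_of_geometric_residues E hΔ
      (E.coFreeKernel_cofinal_left_of_fDelta_surjective dX dY hs hΔ hminX) htfg dX dY hminY,
    prop410iiiDeltaAt_of_geometric_residues E hΔ
      (E.coFreeKernel_cofinal_left_of_fDelta_surjective dX dY hs hΔ hminX) htfg dX dY hminY⟩

/-- **The same from row iii.L03 `E.Surjective` as typed** (`AbsTopIProp410Sub.lean`).
[cite: MochizukiAbsTopI2012, Prop 4.10 (iii) p.60] -/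
theorem prop410iii_of_surjective (dX : X.GroupLevelData) (dY : Y.GroupLevelData)
    (hs : E.Surjective)
    (hΔ : ∀ N : OpenNormalSubgroup Y.DeltaTemp, ∃ H' : CharOpenSubgroup Y.DeltaTemp,
      (cofreeCore H'.toSubgroup).subgroupOf Y.DeltaTemp ≤ N.toSubgroup)
    (hminX : ∀ H : CharOpenSubgroup X.DeltaTemp, ∃ M, IsMinimalCofreeIn H.toSubgroup M)
    (hminY : ∀ H' : CharOpenSubgroup Y.DeltaTemp, ∃ M, IsMinimalCofreeIn H'.toSubgroup M)
    (htfg : IsTopologicallyFinitelyGenerated X.DeltaTemp) :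
    Prop410iiiAt E ∧ Prop410iiiDeltaAt E :=
  E.prop410iii_of_fDelta_surjective dX dY (E.fDelta_surjective_of_map_eq hs.2) hΔ hminX hminY htfg

end DeCuspidalization

end Prop410

end Literature.AnabelianGeometry.AbsoluteAnabelian.AbsTopI

end
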